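import Summits.HodgeConjecture.HodgeConjecture.Theorems.F0P2oBorelEigenfunctionalOfJacquetModule     -- ★ N3 ⟹ N3ᵟ (B-p18 (g28) p827685)
import Summits.HodgeConjecture.HodgeConjecture.Theorems.F0P2oK1occ                                   -- ★ K1occ (p01 p827347): `k1occ_of_u1ThetaDichotomy`
import Summits.HodgeConjecture.HodgeConjecture.Theorems.F0P2oStubDictTorusChar                       -- ★ K2 (p02 p826011): `coe_localDet_localPiEquiv_theta`
import Literature.NumberTheory.Automorphic.Liu2021.Def411WeilCarriersTripleSeparation                   -- ★ `localCharOfCenter_theta_eq` (line-independence of `χ_{f,v}`)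
import HarnessLib

/-!
# Crux `H413`, programme P2, pay-down line `F0_P2GR91NJacquet`, K1 sub-line — THE K1aʷ CLOSER FROM THE LETTERS N3 AND U1

Cell hodgecm-mathlib (D-0151), FLOOR 0, crux H413 = stmt-HodgeConjecture-24833; K1 sub-line `Cruxes/H413/Lines/F0_P2GR91NJacquetK1.lean` (v3a 368644d96141),
registered stub `stub_K1aW : StubK1aWJacquetFunctional` (:196); lead B-p18 (g28) (backstop for the F0P2-p02 (g5) closer).  The registered text asks, for the K1 data
(CM frame, conjugate-symplectic `μ`, continuous unitary `χ_f`, non-split `v`, form congruence `(T, a, h)`), for SOME line class `ε` and SOME character `ψθ` of `E¹_v` with the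
centre-character constraint (`CenterCharSpec`, spelled here by its token-identical ★ Literature twin `IsThetaCenterChar`; the sub-line folds by δ-unfolding) and a NON-ZERO
`(B, χθʷ·δ_B^{1/2})`-eigenfunctional on `X_v(μ, ε, χ_f)`.  This file proves it FROM the two print letters N3 [GelbartRogawski1991 §3.2 (3.2.1)–(3.2.2); Kudla1986 Thm. 2.8]
(★ `thetaType_nonsplit_jacquetModule`, p826177) and U1 [HarrisKudlaSweet1996 Cor. 4.4; Rogawski1992 Prop. 3.4] (★ `u1ThetaDichotomy_nonsplit`, p826953 ∕ p827180), BY NAME: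
* (E) §1 `ψθ`-EXISTENCE: the character `ψθ := (χ_{f,v} ∘ θ ∘ ι) · (μ_v|_{E¹_v})⁻¹` of `E¹_v` (★ `LemD1OfPlace.theta`: `z ↦ (z) ∈ U((ε₀))(L⁺_v)`; `ι` the identity of carriers
  `normOneUnits ↪ S.normOne`) satisfies `IsThetaCenterChar L μ χf ε v ψθ` for EVERY line `ε` — `det θ(z) = z` (★ `coe_localDet_localPiEquiv_theta`), `θ` onto (★ `theta_surjective`),
  and `χ_{f,v}(θ_{ε₀} z) = χ_{f,v}(θ_ε z)` (★ `localCharOfCenter_theta_eq`: the centre inclusion at `v` does not depend on the line presenting it);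
* the OCCURRING line `ε` for this `ψθ` from U1 (★ `k1occ_of_u1ThetaDichotomy hU1`);
* the eigenfunctional from N3 (★ `thetaType_nonsplit_borelEigenfunctional_of_jacquetModule hN3`, i.e. N3ᵟ ⟸ N3 over ★ K1m).
THEOREMS ONLY; conditional on exactly the two named facts `hN3`, `hU1`.  HC_CM is proved only modulo the printed citations until rung 0 closes; nothing here proves a letter.

## References
* [GelbartRogawski1991] Invent. Math. 105 (1991): §3.2 (3.2.1)–(3.2.3) p. 457; §5.1 (5.1.1) p. 465, Lem. 5.1.2; §5.2 p. 467 L25–27; Remark p. 466.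
* [HarrisKudlaSweet1996] JAMS 9 (1996): Cor. 4.4 p. 962.  [Kudla1986] Invent. Math. 83: Thm. 2.8.  [Mok2014] Mem. AMS 235: §1 Notation p. 5.
* [TateThesis1967] in Cassels–Fröhlich: §3.2 Lemma 3.2.1 (local components of an idèle class character).
-/

set_option autoImplicit false
-- the mandated namespace has the single-problem summit's repeated segment (`HodgeConjecture.HodgeConjecture`)
set_option linter.dupNamespace false

noncomputable section

open NumberField IsDedekindDomain MeasureTheory
open scoped Matrix

open Literature.NumberTheory Literature.NumberTheory.Automorphic Literature.NumberTheory.Automorphic.UnitaryGroup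
open Literature.NumberTheory.Automorphic.IdeleClassGroup
open Literature.NumberTheory.Automorphic.Liu2021 Literature.NumberTheory.Automorphic.Liu2021.Def411WeilCarriers
open Literature.NumberTheory.GaloisRepresentations
open Literature.NumberTheory.Rogawski1990
open Literature.NumberTheory.GelbartRogawski1991 Literature.NumberTheory.GelbartRogawski1991.UnitaryDualPair
open Literature.RepresentationTheory.Liu2021

namespace Summit.HodgeConjecture.HodgeConjecture.Cruxes.H413.F0P2oK1aWOfLetters

variable (L : Type) [Field L] [NumberField L] [IsCMField L]

/-! ## §0 The rank-2 standing data `(2, 1, imagUnit)` at `v` carrying `θ` (as in ★ K2 `F0P2oStubDictTorusChar` §4) -/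

/-- `c (imagUnit L) = −imagUnit L`. [cite: Liu2021, App. D §D.1 Step 1] -/
private theorem hcδ' : IsCMField.complexConj L (imagUnit L) = -imagUnit L := complexConj_imagUnit L

/-- `(1 : M₂(L))` is hermitian. [folklore] -/
private theorem one_map_transpose : ((1 : Matrix (Fin 2) (Fin 2) L).map (IsCMField.complexConj L))ᵀ = 1 := by
  rw [Matrix.map_one (IsCMField.complexConj L) (map_zero _) (map_one _), Matrix.transpose_one]

omit [IsCMField L] in
/-- `det (1 : M₂(L)) ≠ 0`. [folklore] -/
private theorem one_det_ne_zero : (1 : Matrix (Fin 2) (Fin 2) L).det ≠ 0 := by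
  rw [Matrix.det_one]; exact one_ne_zero

/-- the local norm-one torus `normOneUnits (c ⊗ 1)` (`x̄ x = 1`) sits inside the standing data's `normOne` (`x x̄ = 1`) — the same
subgroup of `(L ⊗ L⁺_v)ˣ` up to the order of the factors. [cite: Liu2021, App. D §D.1 (l. 5221)] -/
theorem normOneUnits_le_normOne (v : HeightOneSpectrum (𝓞 ↥(maximalRealSubfield L))) :
    normOneUnits (conjLocal L (IsCMField.complexConj L) v) ≤
      (LemD1OfPlace.standingData L v (IsCMField.complexConj L) 2 (1 : Matrix (Fin 2) (Fin 2) L) (hcδ' L) (imagUnit_ne_zero L)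
        le_rfl (one_map_transpose L) (one_det_ne_zero L)).normOne := by
  intro x hx
  rw [OscillatorStandingData.mem_normOne_iff', LemD1OfPlace.standingData_conj_apply, mul_comm]
  exact (mem_normOneUnits_iff x).1 hx

/-! ## §1 (E) `ψθ`-existence, uniformly in the line -/

set_option synthInstance.maxHeartbeats 400000 in
set_option maxHeartbeats 8000000 in
/-- **(E) THE CENTRE CHARACTER EXISTS AND DOES NOT SEE THE LINE.**  For `μ`, `χ_f`, a finite place `v` of `L⁺`: there is a character `ψθ` of
`E¹_v = normOneUnits (c ⊗ 1)` with `IsThetaCenterChar L μ χf ε v ψθ` for EVERY line class `ε` — namely `ψθ := (χ_{f,v} ∘ θ_{1} ∘ ι) · (μ_v|_{E¹_v})⁻¹`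
(`θ_{1} z = (z) ∈ U((1))(L⁺_v)`, ★ `LemD1OfPlace.theta`; `ι` the inclusion `normOneUnits ≤ S.normOne`).  At the line `ε`: every `u ∈ U((ε))(L⁺_v)` is `θ_ε z`
(★ `theta_surjective`), `det θ_ε z = z` (★ `coe_localDet_localPiEquiv_theta`), and `χ_{f,v}(θ_1 z) = χ_{f,v}(θ_ε z)` (★ `localCharOfCenter_theta_eq`).
[cite: GelbartRogawski1991, §5.1 (5.1.1) p. 465; proof of Prop. 5.2.1 p. 467 L25–27] [cite: TateThesis1967, §3.2 Lemma 3.2.1] -/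
theorem exists_forall_isThetaCenterChar (μ : Literature.NumberTheory.Automorphic.IdeleClassGroup L →ₜ* Circle)
    (χf : UnitaryGroup.finAdelicOne (↥(maximalRealSubfield L)) L (IsCMField.complexConj L) →* ℂˣ)
    (v : HeightOneSpectrum (𝓞 ↥(maximalRealSubfield L))) :
    ∃ ψθ : ↥(normOneUnits (conjLocal L (IsCMField.complexConj L) v)) →* ℂˣ, ∀ ε : (↥(maximalRealSubfield L))ˣ, IsThetaCenterChar L μ χf ε v ψθ := by
  refine ⟨(localCharOfCenter (↥(maximalRealSubfield L)) L (IsCMField.complexConj L) (JW (↥(maximalRealSubfield L)) L 1) (JW_apply_ne_zero (↥(maximalRealSubfield L)) L 1) χf v).comp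
      ((LemD1OfPlace.theta L v (IsCMField.complexConj L) 2 (1 : Matrix (Fin 2) (Fin 2) L) (hcδ' L) (imagUnit_ne_zero L) le_rfl (one_map_transpose L) (one_det_ne_zero L) (JW (↥(maximalRealSubfield L)) L 1)).comp (Subgroup.inclusion (normOneUnits_le_normOne L v))) *
    (((toHeckeCharacter L μ).semilocalComponent L v).comp (normOneUnits (conjLocal L (IsCMField.complexConj L) v)).subtype)⁻¹,
    fun ε => ?_⟩
  intro u
  -- `u = θ_ε z`
  obtain ⟨z, rfl⟩ := LemD1OfPlace.theta_surjective L v (IsCMField.complexConj L) 2 (1 : Matrix (Fin 2) (Fin 2) L) (hcδ' L)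
    (imagUnit_ne_zero L) le_rfl (one_map_transpose L) (one_det_ne_zero L) (JW (↥(maximalRealSubfield L)) L ε) (JW_apply_ne_zero (↥(maximalRealSubfield L)) L ε) u
  -- `det θ_ε z = z` (on underlying units), hence `ι (det θ_ε z) = z` in `S.normOne`
  have hd : ((localDet (IsCMField.complexConj L) v
      (isUnit_iff_ne_zero.mpr (by rw [Matrix.det_fin_one]; exact JW_apply_ne_zero (↥(maximalRealSubfield L)) L ε))
      (localPiEquiv L (IsCMField.complexConj L) 1 (JW (↥(maximalRealSubfield L)) L ε) v ((LemD1OfPlace.theta L v (IsCMField.complexConj L) 2 (1 : Matrix (Fin 2) (Fin 2) L) (hcδ' L) (imagUnit_ne_zero L) le_rfl (one_map_transpose L) (one_det_ne_zero L) (JW (↥(maximalRealSubfield L)) L ε)) z)) :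
        ↥(normOneUnits (conjLocal L (IsCMField.complexConj L) v))) : (UnitaryGroup.LocalRing L v)ˣ) = (z : (UnitaryGroup.LocalRing L v)ˣ) :=
    F0P2oStubDictTorusChar.coe_localDet_localPiEquiv_theta L v _ z
  have hι : Subgroup.inclusion (normOneUnits_le_normOne L v) (localDet (IsCMField.complexConj L) v
      (isUnit_iff_ne_zero.mpr (by rw [Matrix.det_fin_one]; exact JW_apply_ne_zero (↥(maximalRealSubfield L)) L ε))
      (localPiEquiv L (IsCMField.complexConj L) 1 (JW (↥(maximalRealSubfield L)) L ε) v ((LemD1OfPlace.theta L v (IsCMField.complexConj L) 2 (1 : Matrix (Fin 2) (Fin 2) L) (hcδ' L) (imagUnit_ne_zero L) le_rfl (one_map_transpose L) (one_det_ne_zero L) (JW (↥(maximalRealSubfield L)) L ε)) z))) = z :=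
    Subtype.ext hd
  rw [MonoidHom.mul_apply, MonoidHom.inv_apply, MonoidHom.comp_apply, MonoidHom.comp_apply, MonoidHom.comp_apply, hι,
    Subgroup.subtype_apply, hd]
  -- the centre inclusion at `v` does not depend on the line: `χ_{f,v}(θ_1 z) = χ_{f,v}(θ_ε z)`
  rw [Def411WeilCarriers.localCharOfCenter_theta_eq (↥(maximalRealSubfield L)) L (IsCMField.complexConj L) 2
    (1 : Matrix (Fin 2) (Fin 2) L) (hcδ' L) (imagUnit_ne_zero L) le_rfl (one_map_transpose L) (one_det_ne_zero L) v
    (JW (↥(maximalRealSubfield L)) L 1) (JW (↥(maximalRealSubfield L)) L ε) (JW_apply_ne_zero (↥(maximalRealSubfield L)) L 1) (JW_apply_ne_zero (↥(maximalRealSubfield L)) L ε) χf z]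

/-! ## §2 The closer -/

set_option synthInstance.maxHeartbeats 400000 in
set_option maxHeartbeats 16000000 in
/-- **Stub K1aʷ «JACQUET FUNCTIONAL FOR χθʷ» of the K1 sub-skeleton (`Cruxes/H413/Lines/F0_P2GR91NJacquetK1.lean` v3a :80–108, statement VERBATIM with
`CenterCharSpec` ↦ ★ `IsThetaCenterChar`) FROM THE PRINT LETTERS N3 AND U1.**  Proof: §1 gives `ψθ` with the centre-character constraint at every line;
★ `k1occ_of_u1ThetaDichotomy hU1` gives a line class `ε` at which `ψθ` OCCURS in `ω¹(γ_v, ψ_v)`; ★ `thetaType_nonsplit_borelEigenfunctional_of_jacquetModule hN3`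
(N3ᵟ ⟸ N3, over ★ K1m) gives the non-zero `(B, χθʷ·δ_B^{1/2})`-eigenfunctional on `X_v(μ, ε, χ_f)` read on `U(Φ₃)(L⁺_v)` (reindexing `e₀ := Equiv.prodUnique (Fin 1) (Fin 1)`).
CONDITIONAL on the named facts `hN3` [GelbartRogawski1991 §3.2; Kudla1986 Thm. 2.8] and `hU1` [HarrisKudlaSweet1996 Cor. 4.4; Rogawski1992 Prop. 3.4] only.
[cite: GelbartRogawski1991, §3.2 (3.2.1)–(3.2.2) p. 457; §5.1 Lem. 5.1.2 pp. 465–466; §5.2 p. 467 L25–27] [cite: Kudla1986, Thm. 2.8] [cite: HarrisKudlaSweet1996, Cor. 4.4 p. 962] -/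
theorem stubK1aW_of_letters
    (hN3 : Literature.NumberTheory.GelbartRogawski1991.thetaType_nonsplit_jacquetModule)
    (hU1 : Literature.NumberTheory.GelbartRogawski1991.u1ThetaDichotomy_nonsplit) :
    ∀ (L : Type) [Field L] [NumberField L] [IsCMField L] (H : Matrix (Fin 3) (Fin 3) L) (hH : (H.map (cmConjRingHom L))ᵀ = H) (hHd : IsUnit H.det)
    {n' : ℕ} (e₁ : Fin 3 × Fin 1 ≃ Fin n') (dV : Fin 3 → L) (hdV : ∀ i, IsCMField.complexConj L (dV i) = dV i) (hdV0 : ∀ i, dV i ≠ 0) (g : GL (Fin 3) L)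
    (hg : ((g : Matrix (Fin 3) (Fin 3) L).map (cmConjRingHom L))ᵀ * H * (g : Matrix (Fin 3) (Fin 3) L) = Matrix.diagonal dV),
    ∀ (μ : Literature.NumberTheory.Automorphic.IdeleClassGroup L →ₜ* Circle) (hμ : IsConjugateSymplectic L μ)
      (χf : UnitaryGroup.finAdelicOne (↥(maximalRealSubfield L)) L (IsCMField.complexConj L) →* ℂˣ),
      Continuous χf → (∀ z, ‖((χf z : ℂˣ) : ℂ)‖ = 1) →
      ∀ (v : HeightOneSpectrum (𝓞 ↥(maximalRealSubfield L))),
        (∀ w : PlacesOver L v, IsCMField.complexConj L • w.1 = w.1) →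
        ∀ (T : GL (Fin 3) (UnitaryGroup.LocalRing L v)) (a : UnitaryGroup.LocalRing L v) (ha : IsUnit a)
          (h : formCongr (conjLocal L (IsCMField.complexConj L) v) T (H.map (algebraMap L (UnitaryGroup.LocalRing L v))) =
            a • (Matrix.of fun i j : Fin 3 => if i.val + j.val + 1 = 3 then (1 : L) else 0).map (algebraMap L (UnitaryGroup.LocalRing L v))),
          ∃ (ε : (↥(maximalRealSubfield L))ˣ) (ψθ : ↥(normOneUnits (conjLocal L (IsCMField.complexConj L) v)) →* ℂˣ),
            IsThetaCenterChar L μ χf ε v ψθ ∧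
            ∃ ℓ : _ →ₗ[ℂ] ℂ, ℓ ≠ 0 ∧
              haveI := locallyCompactSpace_cmBorelU L 3 v
              ∀ (p : ↥(cmBorelTriple L 3 v).P) (w : _),
                ℓ ((((xThetaCM L e₁ dV hdV hdV0 μ hμ χf ε v :
              localPi L (IsCMField.complexConj L) 3 (Matrix.diagonal dV) v →* _).comp
              (localCongr L (IsCMField.complexConj L) g one_ne_zero (by rw [one_smul]; exact hg) v).symm.toMulEquiv.toMonoidHom).comp
            ((cmDatumLocalCongr L v T ha h).trans (localPiEquiv L (IsCMField.complexConj L) 3 H v).symm).toMulEquiv.toMonoidHom) p.1 w) =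
                  (((cmXiTorusChar L v ((toHeckeCharacter L μ).semilocalComponent L v * ((halfModulusChar (UnitaryGroup.LocalRing L v)) ^ 2)⁻¹) ψθ⁻¹ ψθ) ((cmBorelTriple L 3 v).proj p) : ℂˣ) : ℂ) *
                    ((rootDeltaChar (cmBorelTriple L 3 v).P p : ℂˣ) : ℂ) * ℓ w := by
  intro L _ _ _ H hH hHd n' e₁ dV hdV hdV0 g hg μ hμ χf hcont hunit v hv T a ha h
  obtain ⟨ψθ, hψ⟩ := exists_forall_isThetaCenterChar L μ χf v
  obtain ⟨ε, hocc⟩ := F0P2oK1occ.k1occ_of_u1ThetaDichotomy hU1 L (Equiv.prodUnique (Fin 1) (Fin 1)) dV hdV hdV0 μ hμ χf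
    hcont v hv 1 ψθ (hψ 1)
  obtain ⟨ℓ, hℓ0, hℓ⟩ := F0P2oBorelEigenfunctionalOfJacquetModule.thetaType_nonsplit_borelEigenfunctional_of_jacquetModule hN3 L H hH hHd
    e₁ dV hdV hdV0 g hg (Equiv.prodUnique (Fin 1) (Fin 1)) μ hμ χf hcont hunit v hv T a ha h ε ψθ (hψ ε) hocc
  exact ⟨ε, ψθ, hψ ε, ℓ, hℓ0, hℓ⟩

end Summit.HodgeConjecture.HodgeConjecture.Cruxes.H413.F0P2oK1aWOfLetters

end
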